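import Literature.Geometry.Lorentzian.KerrRadiusGradientVector
import Literature.Geometry.Lorentzian.ConvergenceTransport
import Literature.Geometry.Lorentzian.LorentzianMetricProofs
import HarnessLib

/-!
# Region II of Kerr–Schild Kerr: `r` is a time function, with a quantitative speed bound

(family `gr`; namespace `Literature.Geometry.Lorentzian.Kerr`)

Strictly between the horizons, `r₋ < r < r₊` (sub-extremal `|a| < M`), the metric gradient
`W = g⁻¹ dr` of the Kerr–Schild radius (`Kerr.radiusGradVector`, file
`KerrRadiusGradientVector`) has `g(W, W) = Δ/Σ < 0` (`Δ = (r − r₊)(r − r₋) < 0`) and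
`g(V, W) = −2H < 0` for the orienting field `V = −g♯(dt*)`: it is a FUTURE-directed timelike
vector. Hence, at such a point, for every future-directed causal vector `v` of the ingoing
Kerr–Schild chart (time-oriented by `V`):

* `Kerr.radiusGrad_lt_zero_of_isFutureDirected` — `dr(v) = g(W, v) < 0`: `r` strictly
  decreases along future causal curves of region II (O'Neill 1995, §2.5: `r` is a time
  function on region II, decreasing towards the future for the black-hole orientation);
* `Kerr.sqrt_neg_bilin_le_of_isFutureDirected` — the reverse Cauchy–Schwarz inequality
  `g(W, W) g(v, v) ≤ g(W, v)²` (O'Neill 1983, Prop. 5.30) in the quantitative form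
  `√(−g(v, v)) ≤ −dr(v) · √(Σ/(−Δ))`, and, with `Σ ≤ r² + a² ≤ r₊² + a²`,
  `Kerr.sqrt_neg_bilin_le_clockRate_mul` —
  `√(−g(v, v)) ≤ −dr(v) · √((r₊² + a²)/((r₊ − r)(r − r₋)))`:
  the proper-time speed of a causal curve is dominated by the rate of an explicit integrable
  clock of `r`, which is what bounds the timelike diameter of region II (file
  `KerrRegionIIDiameter`).

## References

* B. O'Neill, *The Geometry of Kerr Black Holes*, A K Peters 1995, §2.4–2.5. Key `ONeill1995`.
* B. O'Neill, *Semi-Riemannian geometry*, Academic Press 1983, Ch. 5, Lemma 5.26–Prop. 5.30,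
  p. 145 (timecones, reverse Cauchy–Schwarz). Key `ONeillSemiRiemannian1983`.
* M. Dafermos, I. Rodnianski, Y. Shlapentokh-Rothman, arXiv:1402.7034, §2.1.1–2.1.2
  (`Δ = (r − r₊)(r − r₋)`). Key `DafermosRodnianskiShlapentokhrothman2014`.
-/

noncomputable section

open Set
open scoped RealInnerProductSpace

namespace Literature.Geometry.Lorentzian.Kerr

/-! ### `Δ` between the horizons -/

/-- `a² ≤ M²` for sub-extremal parameters `|a| < M`. [folklore] -/
theorem sq_le_sq_of_isSubextremal {M a : ℝ} (h : |a| < M) : a ^ 2 ≤ M ^ 2 := by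
  have ha : |a| ^ 2 = a ^ 2 := sq_abs a
  nlinarith [abs_nonneg a]

/-- **`Δ < 0` strictly between the horizons** of a sub-extremal Kerr: for `r₋ < r < r₊`,
`r² − 2Mr + a² = (r − r₊)(r − r₋) < 0`. O'Neill 1995, §2.4.
[cite: ONeill1995, §2.4] -/
theorem delta_neg_of_between {M a r : ℝ} (h : |a| < M) (h₁ : rMinus M a < r) (h₂ : r < rPlus M a) :
    r ^ 2 - 2 * M * r + a ^ 2 < 0 := by
  rw [← sub_rPlus_mul_sub_rMinus (sq_le_sq_of_isSubextremal h)]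
  exact mul_neg_of_neg_of_pos (by linarith) (by linarith)

/-- `Σ ≤ r² + a²` (`Σ = 2r² − ‖x⃗‖² + a²` and `r ≤ ‖x⃗‖`), i.e. `Σ = r² + a² cos²θ ≤ r² + a²`.
[cite: DafermosRodnianskiShlapentokhrothman2014, §2.1.1] -/
theorem blSigma_spatial_le (a : ℝ) (x : E4) :
    blSigma a (E4.spatial x) ≤ radius a x ^ 2 + a ^ 2 := by
  rw [blSigma_spatial_eq]
  have hr := radius_nonneg a x
  have hle := radius_le_spatialNorm a x
  nlinarith

/-! ### The gradient of `r` is future timelike on region II -/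

/-- **`g(W, W) < 0` on region II**: `g(W, W) = Δ/Σ` with `Δ < 0 < Σ`. O'Neill 1995, §2.5
(`grad r` is timelike on II). [cite: ONeill1995, §2.5] -/
theorem bilin_radiusGradVector_self_neg {M a : ℝ} (h : |a| < M) {x : E4}
    (h₁ : rMinus M a < radius a x) (h₂ : radius a x < rPlus M a) :
    bilin M a x (radiusGradVector M a x) (radiusGradVector M a x) < 0 := by
  have hx : 0 < radius a x := (IsSubextremal.rMinus_nonneg h).trans_lt h₁
  rw [bilin_radiusGradVector_self hx]
  exact div_neg_of_neg_of_pos (delta_neg_of_between h h₁ h₂) (blSigma_spatial_pos hx)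

/-- **On region II, `dr(v) < 0` for every future-directed causal `v`** (`v` causal for
`g_{M,a}(x)` with `g(V, v) < 0`): `W = g⁻¹dr` is timelike with `g(V, W) = −2H < 0`, so `W` and
`v` lie in the same timecone (O'Neill 1983, Lemma 5.26 ff., p. 145) and `dr(v) = g(W, v) < 0`.
O'Neill 1995, §2.5 ("`r` is a time function on II"). [cite: ONeill1995, §2.5; ONeillSemiRiemannian1983, Ch. 5, p. 145] -/
theorem radiusGrad_lt_zero_of_isFutureDirected [Facts] {M a : ℝ} (h : |a| < M) {x : E4}
    (h₁ : rMinus M a < radius a x) (h₂ : radius a x < rPlus M a) {v : E4}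
    (hvc : bilin M a x v v ≤ 0) (hv0 : v ≠ 0) (hvf : bilin M a x (timeVector M a x) v < 0) :
    radiusGrad a (E4.spatial x) (E4.spatial v) < 0 := by
  have hM : 0 < M := IsSubextremal.pos h
  have hx : 0 < radius a x := (IsSubextremal.rMinus_nonneg h).trans_lt h₁
  have hx0 : x ∈ region a 0 := by
    rw [mem_region, max_self]
    exact hx
  rw [← bilin_radiusGradVector hx v]
  have hH : 0 < scalarH M a x := by
    rw [scalarH_eq_div_blSigma M a hx]
    exact div_pos (mul_pos hM hx) (blSigma_spatial_pos hx)
  -- the timecone lemma in the Lorentzian manifold `(Kerr.region a 0, g_{M,a})` at `x`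
  have hval : (metric M a 0).val ⟨x, hx0⟩ = bilin M a x := metric_val M a 0 ⟨x, hx0⟩
  have hT : (metric M a 0).IsTimelike (x := ⟨x, hx0⟩) (timeVector M a x) := by
    rw [LorentzianMetric.isTimelike_iff, hval]
    exact bilin_timeVector_timeVector_neg hM.le a hx
  have hT' : (metric M a 0).IsTimelike (x := ⟨x, hx0⟩) (radiusGradVector M a x) := by
    rw [LorentzianMetric.isTimelike_iff, hval]
    exact bilin_radiusGradVector_self_neg h h₁ h₂
  have hTT'₀ : bilin M a x (timeVector M a x) (radiusGradVector M a x) < 0 := by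
    rw [bilin_timeVector_radiusGradVector hx]
    linarith
  have hTT' : (metric M a 0).val ⟨x, hx0⟩ (timeVector M a x) (radiusGradVector M a x) < 0 := by
    rw [hval]
    exact hTT'₀
  have hv : (metric M a 0).IsCausal (x := ⟨x, hx0⟩) v := by
    refine ⟨?_, hv0⟩
    rw [hval]
    exact hvc
  have hvf' : (metric M a 0).val ⟨x, hx0⟩ (timeVector M a x) v < 0 := by
    rw [hval]
    exact hvf
  have key := (metric M a 0).val_lt_zero_of_isCausal hT hT' hTT' hv hvf'
  rw [hval] at key
  exact key

/-- **Reverse Cauchy–Schwarz speed bound on region II**: for a future-directed causal `v`,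
`√(−g(v, v)) ≤ −dr(v) · √(Σ/(−Δ))` — from `g(W, W) g(v, v) ≤ g(W, v)²` (O'Neill 1983,
Prop. 5.30) with `g(W, W) = Δ/Σ < 0`, `g(v, v) ≤ 0` and `g(W, v) = dr(v) < 0`.
[cite: ONeillSemiRiemannian1983, Ch. 5, Prop. 5.30 (1), p. 144; ONeill1995, §2.5] -/
theorem sqrt_neg_bilin_le_of_isFutureDirected [Facts] {M a : ℝ} (h : |a| < M) {x : E4}
    (h₁ : rMinus M a < radius a x) (h₂ : radius a x < rPlus M a) {v : E4}
    (hvc : bilin M a x v v ≤ 0) (hv0 : v ≠ 0) (hvf : bilin M a x (timeVector M a x) v < 0) :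
    Real.sqrt (-(bilin M a x v v)) ≤
      -(radiusGrad a (E4.spatial x) (E4.spatial v)) *
        Real.sqrt (blSigma a (E4.spatial x) / (-(radius a x ^ 2 - 2 * M * radius a x + a ^ 2))) := by
  have hx : 0 < radius a x := (IsSubextremal.rMinus_nonneg h).trans_lt h₁
  have hx0 : x ∈ region a 0 := by
    rw [mem_region, max_self]
    exact hx
  have hΔ : radius a x ^ 2 - 2 * M * radius a x + a ^ 2 < 0 := delta_neg_of_between h h₁ h₂
  have hSig : 0 < blSigma a (E4.spatial x) := blSigma_spatial_pos hx
  have hd : radiusGrad a (E4.spatial x) (E4.spatial v) < 0 :=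
    radiusGrad_lt_zero_of_isFutureDirected h h₁ h₂ hvc hv0 hvf
  -- reverse Cauchy–Schwarz for the timelike `W`
  have hval : (metric M a 0).val ⟨x, hx0⟩ = bilin M a x := metric_val M a 0 ⟨x, hx0⟩
  have hT' : (metric M a 0).IsTimelike (x := ⟨x, hx0⟩) (radiusGradVector M a x) := by
    rw [LorentzianMetric.isTimelike_iff, hval]
    exact bilin_radiusGradVector_self_neg h h₁ h₂
  have hCS₀ := (metric M a 0).mul_le_sq_of_isTimelike_holds (x := ⟨x, hx0⟩) hT' v
  have hCS : bilin M a x (radiusGradVector M a x) (radiusGradVector M a x) * bilin M a x v v ≤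
      bilin M a x (radiusGradVector M a x) v ^ 2 := by
    rw [hval] at hCS₀
    exact hCS₀
  rw [bilin_radiusGradVector_self hx, bilin_radiusGradVector hx v] at hCS
  -- `αβ ≤ d²` with `α = −Δ/Σ > 0`, `β = −g(v,v) ≥ 0`, `d = −dr(v) > 0`
  set D := radius a x ^ 2 - 2 * M * radius a x + a ^ 2 with hD_def
  set S := blSigma a (E4.spatial x) with hS_def
  set d := radiusGrad a (E4.spatial x) (E4.spatial v) with hd_def
  set β := -(bilin M a x v v) with hβ_def
  have hβ0 : 0 ≤ β := by rw [hβ_def]; linarith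
  have hkey : β ≤ d ^ 2 * (S / -D) := by
    have h1 : D / S * -β ≤ d ^ 2 := by
      have : bilin M a x v v = -β := by rw [hβ_def, neg_neg]
      rwa [this] at hCS
    have h2 : β * (-D / S) ≤ d ^ 2 := by
      have : β * (-D / S) = D / S * -β := by ring
      linarith
    have hDne : (-D) ≠ 0 := by linarith
    have hDne' : D ≠ 0 := by linarith
    have hSne : S ≠ 0 := hSig.ne'
    calc β = β * (-D / S) * (S / -D) := by
          field_simp
      _ ≤ d ^ 2 * (S / -D) := by
          have hSD : 0 ≤ S / -D := div_nonneg hSig.le (by linarith)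
          exact mul_le_mul_of_nonneg_right h2 hSD
  calc Real.sqrt β ≤ Real.sqrt (d ^ 2 * (S / -D)) := Real.sqrt_le_sqrt hkey
    _ = -d * Real.sqrt (S / -D) := by
        rw [Real.sqrt_mul (sq_nonneg d), Real.sqrt_sq_eq_abs, abs_of_neg hd]

/-- **The clock rate of region II**: with `Σ ≤ r² + a² ≤ r₊² + a²` and `−Δ = (r₊ − r)(r − r₋)`,
`√(−g(v, v)) ≤ −dr(v) · √((r₊² + a²)/((r₊ − r)(r − r₋)))` for every future-directed causal
`v` at a point of region II — the proper-time speed is dominated by the rate of the integrable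
clock `√(r₊² + a²) · arcsin((2r − r₊ − r₋)/(r₊ − r₋))` of `r`. O'Neill 1995, §2.5.
[cite: ONeill1995, §2.5; ONeillSemiRiemannian1983, Ch. 5, Prop. 5.30 (1), p. 144] -/
theorem sqrt_neg_bilin_le_clockRate_mul [Facts] {M a : ℝ} (h : |a| < M) {x : E4}
    (h₁ : rMinus M a < radius a x) (h₂ : radius a x < rPlus M a) {v : E4}
    (hvc : bilin M a x v v ≤ 0) (hv0 : v ≠ 0) (hvf : bilin M a x (timeVector M a x) v < 0) :
    Real.sqrt (-(bilin M a x v v)) ≤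
      -(radiusGrad a (E4.spatial x) (E4.spatial v)) *
        Real.sqrt ((rPlus M a ^ 2 + a ^ 2) /
          ((rPlus M a - radius a x) * (radius a x - rMinus M a))) := by
  have hd : radiusGrad a (E4.spatial x) (E4.spatial v) < 0 :=
    radiusGrad_lt_zero_of_isFutureDirected h h₁ h₂ hvc hv0 hvf
  refine (sqrt_neg_bilin_le_of_isFutureDirected h h₁ h₂ hvc hv0 hvf).trans ?_
  refine mul_le_mul_of_nonneg_left (Real.sqrt_le_sqrt ?_) (by linarith)
  have hΔ : -(radius a x ^ 2 - 2 * M * radius a x + a ^ 2) =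
      (rPlus M a - radius a x) * (radius a x - rMinus M a) := by
    rw [← sub_rPlus_mul_sub_rMinus (sq_le_sq_of_isSubextremal h)]
    ring
  rw [hΔ]
  have hpos : 0 < (rPlus M a - radius a x) * (radius a x - rMinus M a) :=
    mul_pos (by linarith) (by linarith)
  refine div_le_div_of_nonneg_right ?_ hpos.le
  have hr0 : 0 ≤ radius a x := radius_nonneg a x
  calc blSigma a (E4.spatial x) ≤ radius a x ^ 2 + a ^ 2 := blSigma_spatial_le a x
    _ ≤ rPlus M a ^ 2 + a ^ 2 := by nlinarith

end Literature.Geometry.Lorentzian.Kerr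

end
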